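import Summits.MatrixMultiplication.MatrixMultiplication.Theorems.ObstructionDescentUniversalOccurrenceTwoRectangleTallPairTableaux
import Summits.MatrixMultiplication.MatrixMultiplication.Theorems.ObstructionDescentUniversalOccurrenceTwoRectangleTallPairArith

set_option linter.dupNamespace false
set_option autoImplicit false

/-!
# Universal occurrence — two rectangles, THREE-ROW TYPES `(2N-2k-4, 2k+2, 2)`, part R: the value of a valid term (decomp-mm · lens 3 · gen 43)

Route `route-MatrixMultiplication-ObstructionDescent` (sub-problem `MatrixMultiplication`, `ω(ℂ) = 2`); SUPPORT for the crux
`NoOccurrenceObstruction` (`P_O`, item `stmt-MatrixMultiplication-29040`) through the universal-occurrence programme (NODE-g29…g43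
of the decomp-mm cell, lens 3).  Nothing here proves `ω = 2` or closes an item; no `def`, no `sorry`, standard axioms.

**The tall-pair design** (K23 floor law, `δ = 2`, twist `H = {s₁}`): `M = e_T` for the tall-pair tableau (part P); colouring
`g = (0,1,2, 0,1, 0,1, …, 0,…)` (`k` pairs); block structure `p ↦ (X(p) mod 2, ⌊X(p)/2⌋)` with `X = (3 5) · ∏_{j<k} (4j+8 4j+9)`,
i.e. core columns `[(0,s₀),(1,s₀),(0,s₁)] ‖ [(1,s₂),(0,s₂),(1,s₁)]` and `[(0,s_{2j+3}),(1,s_{2j+3})] ‖ [(1,s_{2j+4}),(0,s_{2j+4})]`.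

**Claim** (`tallPair_value_eq_one`).  For every VALID `σ` (`σ₁ s₁ = σ₀ s₁`), `e_T(g ∘ w_σ) ∈ {0,1}`.  Proof: support lemma ⟹
letters; the letter `2` occurs once per block; the tall pair is a twin or an anti-twin with `A₁ = 2` (`tallPair_local_configurations`);
the parity law with remainder gives `#anti pairs ≡ [tall pair anti] (mod 2)`, so the product `q` of the column transpositions
`(4j+8 4j+9)` over the anti pairs, times `(3 4)` if the tall pair is anti, is an EVEN element of `C(T)` with `(g∘w_σ)∘q` a twin word:
`e_T(g∘w_σ) = sgn q · e_T((g∘w_σ)∘q) = 1` (`tallPairTableau_twin_eq_one`).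

[cite: BurgisserIkenmeyer2011, §3.4 (Prop. 3.4), Thm. 4.4] [cite: BurgisserIkenmeyer2017, §5, Thm. 5.9 (proof of (2)), eq. (3.4)]
-/

noncomputable section

open scoped BigOperators

namespace Summit.MatrixMultiplication.MatrixMultiplication.Theorems.ObstructionCalculus

open Literature.Computability.AlgebraicComplexity
open Literature.NumberTheory.DiophantineGeometry

set_option maxHeartbeats 800000 in
/-- **A valid term of the tall-pair design has `e_T(g ∘ w_σ) ∈ {0, 1}`.** [cite: BurgisserIkenmeyer2011, Thm. 4.4]
[cite: BurgisserIkenmeyer2017, Thm. 5.9 (proof of (2))] -/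
theorem tallPair_value_eq_one {N k : ℕ} (hN : 2 * k + 3 ≤ N) {Y : YoungDiagram}
    (hNY : ∀ x ∈ Y.cells, x.1 < N) (T : StdFilling (N * 2) Y)
    (hT : ∀ p : Fin (N * 2), T.1 p = (if (p : ℕ) < 6 then ((p : ℕ) % 3, (p : ℕ) / 3)
      else if (p : ℕ) < 4 * k + 6 then ((p : ℕ) % 2, (p : ℕ) / 2 - 1) else (0, (p : ℕ) - 2 * k - 4)))
    (e : Fin (N * 2) ≃ Fin 2 × Fin N) (g : Fin N → Fin N)
    (hgv : ∀ i : Fin N, ((g i : Fin N) : ℕ) = if (i : ℕ) < 3 then (i : ℕ)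
      else if ((i : ℕ) < 2 * k + 3 ∧ (i : ℕ) % 2 = 0) then 1 else 0)
    (hpos : ∀ (σ : Fin 2 → Equiv.Perm (Fin N)) (n : ℕ) (hn : n < N * 2) (a : Fin 2) (s : Fin N),
      (if n = 3 then 5 else if n = 5 then 3 else if (6 ≤ n ∧ n < 4 * k + 6 ∧ n % 4 = 0) then n + 1
        else if (6 ≤ n ∧ n < 4 * k + 6 ∧ n % 4 = 1) then n - 1 else n) % 2 = (a : ℕ) →
      (if n = 3 then 5 else if n = 5 then 3 else if (6 ≤ n ∧ n < 4 * k + 6 ∧ n % 4 = 0) then n + 1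
        else if (6 ≤ n ∧ n < 4 * k + 6 ∧ n % 4 = 1) then n - 1 else n) / 2 = (s : ℕ) →
      (g ∘ fun q => σ (e q).1 (e q).2) ⟨n, hn⟩ = g (σ a s))
    (σ : Fin 2 → Equiv.Perm (Fin N)) (s1 : Fin N) (hs1 : (s1 : ℕ) = 1) (hH : σ 1 s1 = σ 0 s1)
    (hz : T.polytabloid ℂ hNY (g ∘ fun q => σ (e q).1 (e q).2) ≠ 0) :
    T.polytabloid ℂ hNY (g ∘ fun q => σ (e q).1 (e q).2) = 1 := by
  classical
  set v := (g ∘ fun q => σ (e q).1 (e q).2) with hv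
  have hcolT : ∀ q : Fin (N * 2), (T.1 q).2 =
      if (q : ℕ) < 6 then (q : ℕ) / 3 else if (q : ℕ) < 4 * k + 6 then (q : ℕ) / 2 - 1 else (q : ℕ) - 2 * k - 4 :=
    fun q => by rw [hT]; split_ifs <;> rfl
  obtain ⟨harm, hlt3, hlt2, hinj⟩ := tallPairTableau_support hNY T hT hz
  have hNpos : 0 < N * 2 := by omega
  let P : ℕ → Fin (N * 2) := fun n => ⟨n % (N * 2), Nat.mod_lt _ hNpos⟩
  have hP : ∀ n, n < N * 2 → ((P n : Fin (N * 2)) : ℕ) = n := fun n hn => Nat.mod_eq_of_lt hn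
  let U : ℕ → ℕ := fun n => ((v (P n) : Fin N) : ℕ)
  have hU : ∀ (n : ℕ) (hn : n < N * 2), ((v ⟨n, hn⟩ : Fin N) : ℕ) = U n := by
    intro n hn
    show _ = ((v (P n) : Fin N) : ℕ)
    rw [show (⟨n, hn⟩ : Fin (N * 2)) = P n from Fin.ext (hP n hn).symm]
  have hUp : ∀ x : Fin (N * 2), ((v x : Fin N) : ℕ) = U x := fun x => hU x.1 x.2
  have hU3 : ∀ n, U n < 3 := fun n => hlt3 _
  have hU2 : ∀ n, 6 ≤ n → n < N * 2 → U n < 2 := fun n h6 hn => hlt2 _ (by rw [hP n hn]; exact h6)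
  -- letters in one column are distinct
  have hcolne : ∀ n n', n < N * 2 → n' < N * 2 → n ≠ n' →
      (if n < 6 then n / 3 else if n < 4 * k + 6 then n / 2 - 1 else n - 2 * k - 4) =
        (if n' < 6 then n' / 3 else if n' < 4 * k + 6 then n' / 2 - 1 else n' - 2 * k - 4) → U n ≠ U n' := by
    intro n n' hn hn' hne hc h
    have h' : v (P n) = v (P n') := Fin.ext h
    have := hinj (P n) (P n') (by rw [hcolT, hcolT, hP _ hn, hP _ hn']; exact hc) h'
    have := congrArg Fin.val this
    rw [hP _ hn, hP _ hn'] at this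
    exact hne this
  have d01 := hcolne 0 1 (by omega) (by omega) (by omega) (by simp)
  have d02 := hcolne 0 2 (by omega) (by omega) (by omega) (by simp)
  have d12 := hcolne 1 2 (by omega) (by omega) (by omega) (by simp)
  have d34 := hcolne 3 4 (by omega) (by omega) (by omega) (by simp)
  have d35 := hcolne 3 5 (by omega) (by omega) (by omega) (by simp)
  have d45 := hcolne 4 5 (by omega) (by omega) (by omega) (by simp)
  have hc0 : ∀ j < k, U (4 * j + 6) + U (4 * j + 7) = 1 := by
    intro j hj
    have := hcolne (4 * j + 6) (4 * j + 7) (by omega) (by omega) (by omega) (by split_ifs <;> omega)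
    have := hU2 (4 * j + 6) (by omega) (by omega); have := hU2 (4 * j + 7) (by omega) (by omega); omega
  have hc1 : ∀ j < k, U (4 * j + 8) + U (4 * j + 9) = 1 := by
    intro j hj
    have := hcolne (4 * j + 8) (4 * j + 9) (by omega) (by omega) (by omega) (by split_ifs <;> omega)
    have := hU2 (4 * j + 8) (by omega) (by omega); have := hU2 (4 * j + 9) (by omega) (by omega); omega
  -- reading the letters through `hpos`
  have rd : ∀ (n : ℕ) (hn : n < N * 2) (a : Fin 2) (s : Fin N),
      (if n = 3 then 5 else if n = 5 then 3 else if (6 ≤ n ∧ n < 4 * k + 6 ∧ n % 4 = 0) then n + 1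
        else if (6 ≤ n ∧ n < 4 * k + 6 ∧ n % 4 = 1) then n - 1 else n) % 2 = (a : ℕ) →
      (if n = 3 then 5 else if n = 5 then 3 else if (6 ≤ n ∧ n < 4 * k + 6 ∧ n % 4 = 0) then n + 1
        else if (6 ≤ n ∧ n < 4 * k + 6 ∧ n % 4 = 1) then n - 1 else n) / 2 = (s : ℕ) →
      U n = ((g (σ a s) : Fin N) : ℕ) := by
    intro n hn a s ha hs
    rw [← hU n hn]
    exact congrArg Fin.val (by rw [hv]; exact hpos σ n hn a s ha hs)
  -- the twist: `B₁ = A₁`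
  have hHU : U 5 = U 2 := by
    rw [rd 5 (by omega) 1 s1 (by simp) (by simp [hs1]), rd 2 (by omega) 0 s1 (by simp) (by simp [hs1]), hH]
  -- colour `2` exactly once per block, and the colour sum of block `0`
  have hind : ∀ b : Fin 2, ∑ s : Fin N, (if ((g (σ b s) : Fin N) : ℕ) = 2 then 1 else 0) = 1 := by
    intro b
    rw [Equiv.sum_comp (σ b) (fun x => if ((g x : Fin N) : ℕ) = 2 then 1 else 0)]
    exact sum_tallIndicator_eq hN (fun i => ((g i : Fin N) : ℕ)) hgv
  have oneA : (if U 0 = 2 then 1 else 0) + (if U 2 = 2 then 1 else 0) + (if U 4 = 2 then 1 else 0) = 1 := by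
    have h := hind 0
    rw [sum_slots_tall_eq hN _ (fun s hs => by
      have h0 : U (2 * s) = 0 := harm (P (2 * s)) (by rw [hP _ (by omega)]; omega)
      rw [← rd (2 * s) (by omega) 0 s (by split_ifs <;> omega) (by split_ifs <;> omega), h0]; simp)] at h
    rw [dif_pos (by omega), dif_pos (by omega), dif_pos (by omega)] at h
    rw [← rd 0 (by omega) 0 ⟨0, by omega⟩ (by simp) (by simp), ← rd 2 (by omega) 0 ⟨1, by omega⟩ (by simp) (by simp),
      ← rd 4 (by omega) 0 ⟨2, by omega⟩ (by simp) (by simp)] at h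
    have hp : ∀ j ∈ Finset.range k,
        ((if hj : 2 * j + 3 < N then (if ((g (σ 0 ⟨2 * j + 3, hj⟩) : Fin N) : ℕ) = 2 then 1 else 0) else 0) +
         (if hj : 2 * j + 4 < N then (if ((g (σ 0 ⟨2 * j + 4, hj⟩) : Fin N) : ℕ) = 2 then 1 else 0) else 0)) = 0 := by
      intro j hj
      rw [Finset.mem_range] at hj
      rw [dif_pos (by omega), dif_pos (by omega),
        ← rd (4 * j + 6) (by omega) 0 ⟨2 * j + 3, by omega⟩ (by split_ifs <;> simp <;> omega)
          (by split_ifs <;> simp <;> omega),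
        ← rd (4 * j + 9) (by omega) 0 ⟨2 * j + 4, by omega⟩ (by split_ifs <;> simp <;> omega)
          (by split_ifs <;> simp <;> omega)]
      have := hU2 (4 * j + 6) (by omega) (by omega); have := hU2 (4 * j + 9) (by omega) (by omega)
      rw [if_neg (by omega), if_neg (by omega)]
    rw [Finset.sum_congr rfl hp] at h
    simpa using h
  have oneB : (if U 1 = 2 then 1 else 0) + (if U 5 = 2 then 1 else 0) + (if U 3 = 2 then 1 else 0) = 1 := by
    have h := hind 1
    rw [sum_slots_tall_eq hN _ (fun s hs => by
      have h0 : U (2 * s + 1) = 0 := harm (P (2 * s + 1)) (by rw [hP _ (by omega)]; omega)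
      rw [← rd (2 * s + 1) (by omega) 1 s (by split_ifs <;> simp <;> omega) (by split_ifs <;> omega), h0]; simp)] at h
    rw [dif_pos (by omega), dif_pos (by omega), dif_pos (by omega)] at h
    rw [← rd 1 (by omega) 1 ⟨0, by omega⟩ (by simp) (by simp), ← rd 5 (by omega) 1 ⟨1, by omega⟩ (by simp) (by simp),
      ← rd 3 (by omega) 1 ⟨2, by omega⟩ (by simp) (by simp)] at h
    have hp : ∀ j ∈ Finset.range k,
        ((if hj : 2 * j + 3 < N then (if ((g (σ 1 ⟨2 * j + 3, hj⟩) : Fin N) : ℕ) = 2 then 1 else 0) else 0) +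
         (if hj : 2 * j + 4 < N then (if ((g (σ 1 ⟨2 * j + 4, hj⟩) : Fin N) : ℕ) = 2 then 1 else 0) else 0)) = 0 := by
      intro j hj
      rw [Finset.mem_range] at hj
      rw [dif_pos (by omega), dif_pos (by omega),
        ← rd (4 * j + 7) (by omega) 1 ⟨2 * j + 3, by omega⟩ (by split_ifs <;> simp <;> omega)
          (by split_ifs <;> simp <;> omega),
        ← rd (4 * j + 8) (by omega) 1 ⟨2 * j + 4, by omega⟩ (by split_ifs <;> simp <;> omega)
          (by split_ifs <;> simp <;> omega)]
      have := hU2 (4 * j + 7) (by omega) (by omega); have := hU2 (4 * j + 8) (by omega) (by omega)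
      rw [if_neg (by omega), if_neg (by omega)]
    rw [Finset.sum_congr rfl hp] at h
    simpa using h
  have hsumA : U 0 + U 2 + U 4 + ∑ j ∈ Finset.range k, (U (4 * j + 6) + U (4 * j + 9)) = k + 3 := by
    have hgsum : ∑ i : Fin N, ((g i : Fin N) : ℕ) = k + 3 := sum_tallColouring_eq hN _ hgv
    rw [← Equiv.sum_comp (σ 0) (fun x => ((g x : Fin N) : ℕ))] at hgsum
    rw [sum_slots_tall_eq hN (fun s => ((g (σ 0 s) : Fin N) : ℕ)) (fun s hs => by
      have h0 : U (2 * s) = 0 := harm (P (2 * s)) (by rw [hP _ (by omega)]; omega)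
      rw [← rd (2 * s) (by omega) 0 s (by split_ifs <;> omega) (by split_ifs <;> omega), h0])] at hgsum
    rw [dif_pos (by omega), dif_pos (by omega), dif_pos (by omega)] at hgsum
    rw [← rd 0 (by omega) 0 ⟨0, by omega⟩ (by simp) (by simp), ← rd 2 (by omega) 0 ⟨1, by omega⟩ (by simp) (by simp),
      ← rd 4 (by omega) 0 ⟨2, by omega⟩ (by simp) (by simp)] at hgsum
    have hp : ∀ j ∈ Finset.range k,
        ((if hj : 2 * j + 3 < N then ((g (σ 0 ⟨2 * j + 3, hj⟩) : Fin N) : ℕ) else 0) +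
         (if hj : 2 * j + 4 < N then ((g (σ 0 ⟨2 * j + 4, hj⟩) : Fin N) : ℕ) else 0)) =
          U (4 * j + 6) + U (4 * j + 9) := by
      intro j hj
      rw [Finset.mem_range] at hj
      rw [dif_pos (by omega), dif_pos (by omega),
        ← rd (4 * j + 6) (by omega) 0 ⟨2 * j + 3, by omega⟩ (by split_ifs <;> simp <;> omega)
          (by split_ifs <;> simp <;> omega),
        ← rd (4 * j + 9) (by omega) 0 ⟨2 * j + 4, by omega⟩ (by split_ifs <;> simp <;> omega)
          (by split_ifs <;> simp <;> omega)]
    rw [Finset.sum_congr rfl hp] at hgsum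
    omega
  -- the tall pair: twin or anti-twin
  have htall := tallPair_local_configurations (U 0) (U 1) (U 2) (U 3) (U 4) (U 5) (hU3 0) (hU3 1) (hU3 3) (hU3 4)
    (hU3 5) d01 d02 d12 d34 d35 d45 hHU oneA oneB
  -- the pairs: parity law with remainder
  have hcase : ∀ j < k, (U (4 * j + 8) = U (4 * j + 6) ∧ U (4 * j + 9) + U (4 * j + 6) = 1) ∨
      (U (4 * j + 8) ≠ U (4 * j + 6) ∧ U (4 * j + 9) = U (4 * j + 6)) := by
    intro j hj
    have := hc0 j hj; have := hc1 j hj; have := hU2 (4 * j + 6) (by omega) (by omega)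
    have := hU2 (4 * j + 8) (by omega) (by omega)
    by_cases h : U (4 * j + 8) = U (4 * j + 6)
    · left; exact ⟨h, by omega⟩
    · right; exact ⟨h, by omega⟩
  have hpar := antiPairs_card_add_sum k (fun j => U (4 * j + 6)) (fun j => U (4 * j + 9)) (fun j => U (4 * j + 8)) hcase
  set L := ((Finset.range k).filter (fun j => U (4 * j + 8) ≠ U (4 * j + 6))).toList with hL
  have hLnd : L.Nodup := Finset.nodup_toList _
  have hLmem : ∀ j, j ∈ L ↔ j < k ∧ U (4 * j + 8) ≠ U (4 * j + 6) := by
    intro j; rw [hL, Finset.mem_toList, Finset.mem_filter, Finset.mem_range]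
  have hLlen : L.length = ((Finset.range k).filter (fun j => U (4 * j + 8) ≠ U (4 * j + 6))).card := by
    rw [hL, Finset.length_toList]
  -- the correcting column permutation on the pairs
  let a : ℕ → Fin (N * 2) := fun j => P (4 * j + 8)
  let b : ℕ → Fin (N * 2) := fun j => P (4 * j + 9)
  have hav : ∀ j, j < k → ((a j : Fin (N * 2)) : ℕ) = 4 * j + 8 := fun j hj => hP _ (by omega)
  have hbv : ∀ j, j < k → ((b j : Fin (N * 2)) : ℕ) = 4 * j + 9 := fun j hj => hP _ (by omega)
  have hLk : ∀ j ∈ L, j < k := fun j hj => ((hLmem j).1 hj).1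
  have hab : ∀ i ∈ L, ∀ j ∈ L, a i ≠ b j := by
    intro i hi j hj h
    have := congrArg Fin.val h; rw [hav i (hLk i hi), hbv j (hLk j hj)] at this; omega
  have ha : ∀ i ∈ L, ∀ j ∈ L, a i = a j → i = j := by
    intro i hi j hj h
    have := congrArg Fin.val h; rw [hav i (hLk i hi), hav j (hLk j hj)] at this; omega
  have hb : ∀ i ∈ L, ∀ j ∈ L, b i = b j → i = j := by
    intro i hi j hj h
    have := congrArg Fin.val h; rw [hbv i (hLk i hi), hbv j (hLk j hj)] at this; omega
  set qp : Equiv.Perm (Fin (N * 2)) := (L.map fun j => Equiv.swap (a j) (b j)).prod with hqp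
  obtain ⟨hq1, hq2⟩ := swapList_apply_pair a b L hLnd hab ha hb
  have hsqp : Equiv.Perm.sign qp = (-1) ^ L.length := by
    rw [hqp, sign_swapList a b L (fun j hj => hab j hj j hj)]
  have hqfix : ∀ p : Fin (N * 2), ¬ (8 ≤ (p : ℕ) ∧ (p : ℕ) < 4 * k + 6 ∧ (p : ℕ) % 4 < 2 ∧ ((p : ℕ) - 8) / 4 ∈ L) →
      qp p = p := by
    intro p hp
    apply hq2
    intro j hj
    have hjk := hLk j hj
    constructor
    · intro h
      have := congrArg Fin.val h; rw [hav j hjk] at this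
      exact hp ⟨by omega, by omega, by omega, by rw [show ((p : ℕ) - 8) / 4 = j by omega]; exact hj⟩
    · intro h
      have := congrArg Fin.val h; rw [hbv j hjk] at this
      exact hp ⟨by omega, by omega, by omega, by rw [show ((p : ℕ) - 8) / 4 = j by omega]; exact hj⟩
  have hqpC : qp ∈ T.colStab := by
    rw [StdFilling.mem_colStab]
    intro p
    by_cases hp : 8 ≤ (p : ℕ) ∧ (p : ℕ) < 4 * k + 6 ∧ (p : ℕ) % 4 < 2 ∧ ((p : ℕ) - 8) / 4 ∈ L
    · obtain ⟨hp1, hp2, hp3, hp4⟩ := hp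
      have hjk : ((p : ℕ) - 8) / 4 < k := by omega
      rcases (show (p : ℕ) % 4 = 0 ∨ (p : ℕ) % 4 = 1 by omega) with h0 | h1
      · have hpa : p = a (((p : ℕ) - 8) / 4) := Fin.ext (by rw [hav _ hjk]; omega)
        have e1 := (hq1 _ hp4).1
        rw [← hpa] at e1
        rw [e1, hcolT, hcolT, hbv _ hjk]
        rw [if_neg (by omega), if_pos (by omega), if_neg (by omega), if_pos hp2]
        omega
      · have hpb : p = b (((p : ℕ) - 8) / 4) := Fin.ext (by rw [hbv _ hjk]; omega)
        have e1 := (hq1 _ hp4).2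
        rw [← hpb] at e1
        rw [e1, hcolT, hcolT, hav _ hjk]
        rw [if_neg (by omega), if_pos (by omega), if_neg (by omega), if_pos hp2]
        omega
    · rw [hqfix p hp]
  -- positions `0 … 5`
  obtain ⟨p3, hp3⟩ : ∃ p : Fin (N * 2), (p : ℕ) = 3 := ⟨⟨3, by omega⟩, rfl⟩
  obtain ⟨p4, hp4⟩ : ∃ p : Fin (N * 2), (p : ℕ) = 4 := ⟨⟨4, by omega⟩, rfl⟩
  have hq3 : qp p3 = p3 := hqfix p3 (fun h => by omega)
  have hq4 : qp p4 = p4 := hqfix p4 (fun h => by omega)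
  -- the tall correction `t ∈ {1, (3 4)}` making `qp * t` even, with the values at `3, 4` after correction
  obtain ⟨t, htC, hsign, htfix, ht3, ht4⟩ : ∃ t : Equiv.Perm (Fin (N * 2)), t ∈ T.colStab ∧
      Equiv.Perm.sign (qp * t) = 1 ∧ (∀ p : Fin (N * 2), (p : ℕ) ≠ 3 → (p : ℕ) ≠ 4 → t p = p) ∧
      ((v (qp (t p3)) : Fin N) : ℕ) = U 0 ∧ ((v (qp (t p4)) : Fin N) : ℕ) = U 1 := by
    rcases htall with ⟨t30, t41⟩ | ⟨t40, t31, t22⟩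
    · -- tall twin: the number of anti pairs is even
      have hU012 : U 0 + U 2 + U 4 = 3 := by
        have := hU3 0; have := hU3 1; have := hU3 2; omega
      have hev : Even L.length := by
        rw [hLlen]; exact ⟨∑ j ∈ (Finset.range k).filter (fun j => U (4 * j + 8) ≠ U (4 * j + 6)), U (4 * j + 6),
          by omega⟩
      refine ⟨1, StdFilling.one_mem_colStab T, ?_, fun p _ _ => rfl, ?_, ?_⟩
      · rw [mul_one, hsqp]; exact Even.neg_one_pow hev
      · show ((v (qp p3) : Fin N) : ℕ) = U 0; rw [hq3, hUp, hp3]; exact t30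
      · show ((v (qp p4) : Fin N) : ℕ) = U 1; rw [hq4, hUp, hp4]; exact t41
    · -- tall anti-twin: the number of anti pairs is odd
      have hU0 : U 0 < 2 := by have := hU3 0; omega
      have hodd : Odd L.length := by
        rw [hLlen]
        exact ⟨∑ j ∈ (Finset.range k).filter (fun j => U (4 * j + 8) ≠ U (4 * j + 6)), U (4 * j + 6) + U 0 - 1,
          by omega⟩
      have h34 : p3 ≠ p4 := fun h => by have := congrArg Fin.val h; omega
      refine ⟨Equiv.swap p3 p4, ?_, ?_, ?_, ?_, ?_⟩
      · exact StdFilling.swap_mem_colStab (by rw [hcolT, hcolT, hp3, hp4]; simp)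
      · have h1 : Equiv.Perm.sign qp = -1 := by rw [hsqp]; exact Odd.neg_one_pow hodd
        rw [Equiv.Perm.sign_mul, h1, Equiv.Perm.sign_swap h34]; decide
      · intro p h3' h4'
        exact Equiv.swap_apply_of_ne_of_ne (fun h => h3' (by rw [h, hp3])) (fun h => h4' (by rw [h, hp4]))
      · rw [Equiv.swap_apply_left, hq4, hUp, hp4]; exact t40
      · rw [Equiv.swap_apply_right, hq3, hUp, hp3]; exact t31
  set q : Equiv.Perm (Fin (N * 2)) := qp * t with hq
  have hqC : q ∈ T.colStab := StdFilling.mul_mem_colStab hqpC htC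
  have hqv : ∀ p, q p = qp (t p) := fun p => rfl
  have hqfix' : ∀ p : Fin (N * 2), ((p : ℕ) < 3 ∨ 4 * k + 6 ≤ (p : ℕ) ∨
      (6 ≤ (p : ℕ) ∧ (p : ℕ) < 4 * k + 6 ∧ ((p : ℕ) + 2) % 4 < 2)) → q p = p := by
    intro p hp
    rw [hqv, htfix p (by omega) (by omega)]
    exact hqfix p (fun h => by omega)
  -- `v ∘ q` is a twin word
  have htw : T.polytabloid ℂ hNY (v ∘ ⇑q) = 1 := by
    apply tallPairTableau_twin_eq_one hNY T hT (by omega)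
    · intro p hp
      show ((v (q p) : Fin N) : ℕ) = 0
      rw [hqfix' p (Or.inr (Or.inl hp))]; exact harm p hp
    · intro p hp; exact hlt3 _
    · intro p h6 hp hr
      show ((v (q p) : Fin N) : ℕ) < 2
      rw [hqfix' p (Or.inr (Or.inr ⟨h6, hp, hr⟩))]; exact hlt2 _ h6
    · intro p p' hp hp' hpp
      have h : v (q p) = v (q p') := hpp
      rw [hqfix' p (Or.inl hp), hqfix' p' (Or.inl hp')] at h
      exact hinj p p' (by rw [hcolT, hcolT, if_pos (by omega), if_pos (by omega)]; omega) h
    · intro p p' h6 hp h6' hp' hr hr' hbase hpp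
      have h : v (q p) = v (q p') := hpp
      rw [hqfix' p (Or.inr (Or.inr ⟨h6, hp, hr⟩)), hqfix' p' (Or.inr (Or.inr ⟨h6', hp', hr'⟩))] at h
      exact hinj p p' (by
        rw [hcolT, hcolT, if_neg (by omega), if_pos hp, if_neg (by omega), if_pos hp']; omega) h
    · intro p hp
      show v (q _) = v (q p)
      rw [hqfix' p (Or.inl hp)]
      apply Fin.ext
      rw [hUp p]
      rcases (show (p : ℕ) = 0 ∨ (p : ℕ) = 1 ∨ (p : ℕ) = 2 by omega) with h0 | h1 | h2
      · rw [show (⟨(p : ℕ) + 3, by omega⟩ : Fin (N * 2)) = p3 from Fin.ext (by rw [hp3]; show (p : ℕ) + 3 = 3; omega),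
          hqv, ht3, h0]
      · rw [show (⟨(p : ℕ) + 3, by omega⟩ : Fin (N * 2)) = p4 from Fin.ext (by rw [hp4]; show (p : ℕ) + 3 = 4; omega),
          hqv, ht4, h1]
      · rw [hqv, htfix _ (by dsimp only; omega) (by dsimp only; omega),
          hqfix _ (fun h => by dsimp only at h; omega), hUp]
        show U ((p : ℕ) + 3) = U (p : ℕ)
        rw [h2]; exact hHU
    · intro p h6 hp hr
      show v (q _) = v (q p)
      rw [hqfix' p (Or.inr (Or.inr ⟨h6, hp, hr⟩)), hqv, htfix _ (by dsimp only; omega)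
        (by dsimp only; omega)]
      obtain ⟨j, hj⟩ : ∃ j : ℕ, ((p : ℕ) - 6) / 4 = j := ⟨_, rfl⟩
      have hjk : j < k := by omega
      have hc0j := hc0 j hjk
      have hc1j := hc1 j hjk
      have hU6 := hU2 (4 * j + 6) (by omega) (by omega)
      have hU8 := hU2 (4 * j + 8) (by omega) (by omega)
      apply Fin.ext
      rw [hUp p]
      by_cases hjL : j ∈ L
      · have hanti := ((hLmem j).1 hjL).2
        rcases (show (p : ℕ) % 4 = 2 ∨ (p : ℕ) % 4 = 3 by omega) with h0 | h1
        · have hpa : (⟨(p : ℕ) + 2, by omega⟩ : Fin (N * 2)) = a j :=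
            Fin.ext (by show (p : ℕ) + 2 = _; rw [hav j hjk]; omega)
          rw [hpa, (hq1 j hjL).1, show (p : ℕ) = 4 * j + 6 by omega]
          show U (4 * j + 9) = U (4 * j + 6)
          omega
        · have hpb : (⟨(p : ℕ) + 2, by omega⟩ : Fin (N * 2)) = b j :=
            Fin.ext (by show (p : ℕ) + 2 = _; rw [hbv j hjk]; omega)
          rw [hpb, (hq1 j hjL).2, show (p : ℕ) = 4 * j + 7 by omega]
          show U (4 * j + 8) = U (4 * j + 7)
          omega
      · have htwin : U (4 * j + 8) = U (4 * j + 6) := by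
          by_contra h; exact hjL ((hLmem j).2 ⟨hjk, h⟩)
        rw [hqfix _ (fun h => hjL (by rw [show j = (((p : ℕ) + 2) - 8) / 4 by omega]; simpa using h.2.2.2)), hUp]
        show U ((p : ℕ) + 2) = U (p : ℕ)
        rcases (show (p : ℕ) % 4 = 2 ∨ (p : ℕ) % 4 = 3 by omega) with h0 | h1
        · rw [show (p : ℕ) + 2 = 4 * j + 8 by omega, show (p : ℕ) = 4 * j + 6 by omega]
          exact htwin
        · rw [show (p : ℕ) + 2 = 4 * j + 9 by omega, show (p : ℕ) = 4 * j + 7 by omega]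
          omega
  -- `e_T(v ∘ q) = sgn(q) · e_T(v)`
  have key := congrFun (StdFilling.wordPerm_polytabloid_of_mem_colStab (k := ℂ) hNY T hqC) v
  rw [wordPerm_apply, Pi.smul_apply, smul_eq_mul, hsign, htw] at key
  simpa using key.symm

end Summit.MatrixMultiplication.MatrixMultiplication.Theorems.ObstructionCalculus
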